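import Literature.LinearAlgebra.Matrix.RectangularCongruenceInertia
import Literature.NumberTheory.Rogawski1990.SingularLocalConjugacy
import Literature.NumberTheory.Rogawski1990.ArchTwistGramEmbedding
import Literature.NumberTheory.Automorphic.UnitaryGroupArchimedeanPlaces
import HarnessLib

/-!
# Local conjugacy at a SINGULAR semisimple class, ARCHIMEDEAN clause: hermitian forms over `E ⊗ ℝ` are classified by their signatures at the
# complex places, so equal BLOCK signatures in the frame give a `γ`-centralising congruence (Rogawski 1990, §3.8 Prop. 3.8.1 (d) at `v ∣ ∞`)

Topic `NumberTheory/Rogawski1990`; namespace `Literature.NumberTheory.Rogawski1990`.  THEOREMS ONLY (no definition, no named fact, no instance, no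
notation, no `sorry`).  Cell `pub/hodgecm-mathlib`, ENGINE T1 (crux H413 = `stmt-HodgeConjecture-24833`), row O7 «singular semisimple classes», piece
**(h3′) ARCH** of the trunk's `hreal` cut (F0P5a-p03 TRUNK WORDS #7∕#8, O7 OWNER RULE (F2) 2026-08-31: «only `hanis` — NO total definiteness; equal block
signatures at every complex place, not merely both definite») = the ARCHIMEDEAN twin of ★ (h1) `SingularLocalConjugacy` (non-split finite `v`:
determinant classes of the blocks) and ★ (h2) `SingularLocalConjugacySplit` (split finite `v`: no condition), in the same socket shape.
HC_CM is proved only modulo the printed citations until rung 0 closes.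

THE MATHEMATICS [Rogawski1990, §3.8 Prop. 3.8.1 (d) p. 30; §3.3 Prop. 3.3.1 p. 22].  `E ∕ F` number fields, `c ∈ Aut(E∕F)`, `c ≠ 1` fixing every
infinite place (so `E` has no real place and `c ⊗ 1` — ★ `UnitaryGroup.conjMixed` — is complex conjugation on every coordinate of `E ⊗_ℚ ℝ = ∏_w ℂ`,
★ `evalC_conjMixed`; the CM situation `F = L⁺`, `E = L`).  A `(c ⊗ 1)`-hermitian matrix `G` over `E ⊗ ℝ` is a family of complex hermitian matrices
`G_w` (★ `UnitaryGroup.evalC`), and `ᵗ((c⊗1)t) · G · t = G′` (★ `Rogawski1990.twistGram`) holds iff `t_wᴴ G_w t_w = G′_w` at every complex place `w`.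
By SYLVESTER'S LAW OF INERTIA (Horn–Johnson Thm. 4.5.8: non-degenerate complex hermitian matrices are congruent iff they have the same inertia —
the existence half is ★ `Literature.LinearAlgebra.Matrix.exists_isUnit_det_eq_mul_mul_conjTranspose_of_card_eq`), invertible hermitian `G, G′`
over `E ⊗ ℝ` are congruent iff `G_w`, `G′_w` have the same positive index at every `w` (§2).  For a singular non-central `γ` with adapted frame `P`
(`γ P = P (a·1 ⊕ᶠ b·1)`) and `G, G′` block diagonal in the frame, blockwise congruences assemble to a `t` COMMUTING WITH `γ` (★ B-p14 FILE B §1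
`exists_commute_twistGram_eq_of_blocks`, any commutative ring), whence §3: **equal signatures of the corresponding blocks at every complex place ⇒
`∃ t ∈ GL(E ⊗ ℝ)`, `t γ = γ t`, `ᵗ((c⊗1)t) G t = G′`.**  Where the ternary form is indefinite the signature of the plane block is the archimedean
half of Kottwitz's `|𝓡| = 2` obstruction [Rogawski1990, 3.8.1 (d)]; where it is definite the hypothesis is automatic (§3 `…_of_posDef`).

WHAT IS PROVED
* §1 (over `ℂ`, any finite index type) `exists_conjTranspose_mul_mul_eq_of_card_pos_eigenvalues_eq` — `det A, det B ≠ 0` and `#pos(A) = #pos(B)` ⇒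
  `gᴴ A g = B`, `g ∈ GL(ℂ)` (the non-degenerate dress of ★ `exists_isUnit_det_eq_mul_mul_conjTranspose_of_card_eq`); `card_pos_eigenvalues_eq_card_of_posDef`.
* §2 (over `E ⊗ ℝ`, any index type) `matrix_eq_of_forall_map_evalC_eq`, `exists_matrix_forall_map_evalC_eq`,
  `isHermitian_map_evalC_of_transpose_map_conjMixed`, `twistGram_conjMixed_map_evalC` (`(ᵗ((c⊗1)T) G T)_w = T_wᴴ G_w T_w`),
  **`exists_units_twistGram_conjMixed_eq_of_signatures`** («hermitian forms over `E ⊗ ℝ` with unit determinants and equal positive indices at every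
  complex place are congruent» — the arch twin of ★ `exists_units_twistGram_eq_of_split`).
* §3 (frame `N₁ ⊕ N₂`) `conjMixed_conjMixed_apply`, **`exists_commute_twistGram_conjMixed_eq_of_block_signatures`** = (h3′), `posDef_blocks_map_evalC`,
  `exists_commute_twistGram_conjMixed_eq_of_posDef` = (h3) «both `≫ 0` at every complex place».
* §4 CM editions (`F = L⁺`, `E = L`, `c = complexConj L`; ★ `IsCMField.complexConj_ne_one`, ★ `complexConj_smul_infinitePlace`):
  `exists_units_twistGram_arch_eq_of_signatures_cm`, **`exists_commute_twistGram_arch_eq_of_block_signatures_cm`**,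
  `exists_commute_twistGram_arch_eq_of_posDef_cm` — the letters of the (h5) assembler ★ `Rogawski1990/SingularObsHasse` (`N₁ := 2`, `N₂ := 1`).

## References
* [Rogawski1990] J. D. Rogawski, *Automorphic Representations of Unitary Groups in Three Variables*, Ann. of Math. Stud. 123 (1990), §3.3
  Prop. 3.3.1 p. 22 (local conditions at every place, in particular at `∞`), §3.8 Prop. 3.8.1 (d) p. 30 (`𝓡(G′_{γ′}∕F_v)` at a singular class).
* [HornJohnson2013] R. A. Horn, C. R. Johnson, *Matrix Analysis*, 2nd ed., CUP 2013, Thm. 4.5.8 (Sylvester's law of inertia), §7.1 (positive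
  definite matrices: principal submatrices, *congruence).
* [BorelJacquet1979] A. Borel, H. Jacquet, *Automorphic forms and automorphic representations*, PSPM 33.1 (1979), §4.1 (`G(E ⊗ ℝ) = ∏_{w∣∞} G(E_w)`).
* [Landherr1936HermitianForms] W. Landherr, *Äquivalenz Hermitescher Formen über einem beliebigen algebraischen Zahlkörper*, Abh. Math. Sem.
  Hamburg 11 (1936) 245–248 (signatures at the infinite places as the archimedean invariants).
-/

set_option autoImplicit false

noncomputable section

open NumberField NumberField.InfinitePlace Matrix
open scoped Matrix MatrixGroups ComplexConjugate ComplexOrder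

namespace Literature.NumberTheory.Rogawski1990

open Literature.NumberTheory.Automorphic.UnitaryGroup (finSum finSum_map det_finSum transpose_finSum_map conjMixed evalC evalC_apply
  evalC_conjMixed mixedSpace_ext complexConj_smul_infinitePlace)
open NumberField.mixedEmbedding (mixedSpace)

/-! ## §1 Sylvester's law of inertia over `ℂ`, existence direction: equal positive index ⇒ congruent -/

section Complex

variable {ι : Type} [Fintype ι] [DecidableEq ι]

/-- **SYLVESTER'S LAW OF INERTIA over `ℂ`, EXISTENCE DIRECTION, non-degenerate dress.**  Two complex hermitian matrices with NON-ZERO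
determinant and the same number of positive eigenvalues are congruent: `gᴴ · A · g = B` for some `g ∈ GL(ℂ)`.  This is ★
`Literature.LinearAlgebra.Matrix.exists_isUnit_det_eq_mul_mul_conjTranspose_of_card_eq` (Horn–Johnson Thm. 4.5.8, converse half: equal
numbers of positive AND of negative eigenvalues ⇒ congruent) with the negative count discharged — no zero eigenvalues when `det ≠ 0`
(`IsHermitian.det_eq_prod_eigenvalues`), so `#neg = n − #pos` (★ `card_pos_add_card_neg_add_card_zero_eigenvalues`).  The other direction
(congruence preserves the positive index) is ★ `Landherr.card_pos_eigenvalues_eq_of_congr`. [cite: HornJohnson2013, Thm. 4.5.8 (Sylvester's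
law of inertia)] -/
theorem exists_conjTranspose_mul_mul_eq_of_card_pos_eigenvalues_eq {A B : Matrix ι ι ℂ} (hA : A.IsHermitian) (hB : B.IsHermitian)
    (hA0 : A.det ≠ 0) (hB0 : B.det ≠ 0)
    (h : (Finset.univ.filter fun i => 0 < hA.eigenvalues i).card = (Finset.univ.filter fun i => 0 < hB.eigenvalues i).card) :
    ∃ g : GL ι ℂ, (g : Matrix ι ι ℂ)ᴴ * A * (g : Matrix ι ι ℂ) = B := by
  -- no zero eigenvalues on either side
  have hz : ∀ {C : Matrix ι ι ℂ} (hC : C.IsHermitian), C.det ≠ 0 → (Finset.univ.filter fun i => hC.eigenvalues i = 0).card = 0 := by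
    intro C hC hC0
    rw [Finset.card_eq_zero, Finset.filter_eq_empty_iff]
    intro i _ hi
    apply hC0
    rw [hC.det_eq_prod_eigenvalues]
    exact Finset.prod_eq_zero (Finset.mem_univ i) (by rw [hi]; simp)
  have hA3 := Literature.LinearAlgebra.Matrix.card_pos_add_card_neg_add_card_zero_eigenvalues hA
  have hB3 := Literature.LinearAlgebra.Matrix.card_pos_add_card_neg_add_card_zero_eigenvalues hB
  rw [hz hA hA0] at hA3
  rw [hz hB hB0] at hB3
  have hneg : (Finset.univ.filter fun i => hB.eigenvalues i < 0).card = (Finset.univ.filter fun i => hA.eigenvalues i < 0).card := by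
    omega
  obtain ⟨S, hS, hBS⟩ := Literature.LinearAlgebra.Matrix.exists_isUnit_det_eq_mul_mul_conjTranspose_of_card_eq hA hB h.symm hneg
  have hS' : Sᴴ.det ≠ 0 := by
    rw [Matrix.det_conjTranspose]
    exact star_ne_zero.mpr hS.ne_zero
  refine ⟨Matrix.GeneralLinearGroup.mkOfDetNeZero Sᴴ hS', ?_⟩
  change Sᴴᴴ * A * Sᴴ = B
  rw [Matrix.conjTranspose_conjTranspose, ← hBS]

/-- Positive definite hermitian matrices have full positive index (all eigenvalues positive). [cite: HornJohnson2013, Thm. 7.2.1] -/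
theorem card_pos_eigenvalues_eq_card_of_posDef {A : Matrix ι ι ℂ} (hA : A.PosDef) (h : A.IsHermitian) :
    (Finset.univ.filter fun i => 0 < h.eigenvalues i).card = Fintype.card ι := by
  rw [Finset.filter_true_of_mem fun i _ => ?_, Finset.card_univ]
  have := hA.eigenvalues_pos i
  convert this using 2

end Complex

/-! ## §2 Over `E ⊗ ℝ` (no real places): congruence is decided place by place, by the signatures -/

section Mixed

variable (F E : Type) [Field F] [Field E] [NumberField E] [Algebra F E] (c : E ≃ₐ[F] E)
  (hc : c ≠ 1) (hfix : ∀ w : InfinitePlace E, c • w = w)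

section AnyIndex

variable {m n : Type} [Fintype m] [Fintype n] [DecidableEq n]

omit [NumberField E] [Fintype m] [Fintype n] [DecidableEq n] in
include hc hfix in
/-- With no real places, a matrix over `E ⊗ ℝ` is determined by its complex coordinates `X ↦ X_w` (★ `mixedSpace_ext`, entrywise).
[cite: BorelJacquet1979, §4.1] -/
theorem matrix_eq_of_forall_map_evalC_eq {X Y : Matrix m n (mixedSpace E)}
    (h : ∀ w : {w : InfinitePlace E // IsComplex w}, X.map (evalC E w) = Y.map (evalC E w)) : X = Y :=
  Matrix.ext fun i j => mixedSpace_ext F E c hc hfix fun w => by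
    have hij := congrFun (congrFun (h w) i) j
    simpa only [Matrix.map_apply, evalC_apply] using hij

omit [NumberField E] [Fintype m] [Fintype n] [DecidableEq n] in
/-- Every family of complex matrices `(g_w)_w` is the family of coordinates of a matrix over `E ⊗ ℝ` (put `0` in the absent real
coordinates). [cite: BorelJacquet1979, §4.1] -/
theorem exists_matrix_forall_map_evalC_eq (g : {w : InfinitePlace E // IsComplex w} → Matrix m n ℂ) :
    ∃ T : Matrix m n (mixedSpace E), ∀ w : {w : InfinitePlace E // IsComplex w}, T.map (evalC E w) = g w :=
  ⟨Matrix.of fun i j => ((fun _ => 0, fun w => g w i j) : mixedSpace E), fun _ => Matrix.ext fun _ _ => rfl⟩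

omit [NumberField E] [Fintype n] [DecidableEq n] in
include hc hfix in
/-- The `w`-coordinate of a `(c ⊗ 1)`-hermitian matrix over `E ⊗ ℝ` is a hermitian complex matrix (★ `evalC_conjMixed`: `c ⊗ 1` is complex
conjugation on the `w`-coordinate). [cite: BorelJacquet1979, §4.1] -/
theorem isHermitian_map_evalC_of_transpose_map_conjMixed {G : Matrix n n (mixedSpace E)} (hG : (G.map (conjMixed F E c))ᵀ = G)
    (w : {w : InfinitePlace E // IsComplex w}) : (G.map (evalC E w)).IsHermitian := by
  have hfun : (⇑(evalC E w) ∘ ⇑(conjMixed F E c)) = (star ∘ ⇑(evalC E w)) :=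
    funext fun x => evalC_conjMixed F E c (hfix w.1) hc x
  have key := congrArg (fun A : Matrix n n (mixedSpace E) => A.map (evalC E w)) hG
  simp only [Matrix.transpose_map, Matrix.map_map, hfun] at key
  rw [← Matrix.map_map, ← Matrix.transpose_map] at key
  exact key

omit [NumberField E] [DecidableEq n] in
include hc hfix in
/-- The `w`-coordinate of a transported Gram matrix: `(ᵗ((c⊗1)T) · G · T)_w = T_wᴴ · G_w · T_w`. [cite: Rogawski1990, §3.3 p. 21]
[cite: BorelJacquet1979, §4.1] -/
theorem twistGram_conjMixed_map_evalC (G T : Matrix n n (mixedSpace E)) (w : {w : InfinitePlace E // IsComplex w}) :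
    (twistGram (conjMixed F E c) G T).map (evalC E w) = (T.map (evalC E w))ᴴ * G.map (evalC E w) * T.map (evalC E w) := by
  rw [twistGram_map (conjMixed F E c) G (starRingEnd ℂ) (evalC E w) (fun x => evalC_conjMixed F E c (hfix w.1) hc x) T,
    twistGram_starRingEnd]

omit [NumberField E] in
include hc hfix in
/-- **HERMITIAN FORMS OVER `E ⊗ ℝ` ARE CLASSIFIED BY THEIR SIGNATURES AT THE COMPLEX PLACES** (`E` with no real place, `c ⊗ 1` the
involution).  If `G, G′` are `(c ⊗ 1)`-hermitian with unit determinants and, at every complex place `w`, `G_w` and `G′_w` have the same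
number of positive eigenvalues, then `ᵗ((c⊗1)t) · G · t = G′` for some `t ∈ GL(E ⊗ ℝ)`: Sylvester place by place (§1
`exists_conjTranspose_mul_mul_eq_of_card_pos_eigenvalues_eq`), glued over `E ⊗ ℝ = ∏_w ℂ`.  The archimedean counterpart of ★
`exists_units_twistGram_eq_of_split` (split finite places: no condition) and of the determinant-class criterion at non-split finite places.
[cite: HornJohnson2013, Thm. 4.5.8] [cite: Rogawski1990, §3.3 Prop. 3.3.1 p. 22 (local conditions at `∞`)] [cite: BorelJacquet1979, §4.1] -/
theorem exists_units_twistGram_conjMixed_eq_of_signatures {G G' : Matrix n n (mixedSpace E)}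
    (hG : (G.map (conjMixed F E c))ᵀ = G) (hG' : (G'.map (conjMixed F E c))ᵀ = G') (hGd : IsUnit G.det) (hG'd : IsUnit G'.det)
    (hsig : ∀ (w : {w : InfinitePlace E // IsComplex w}) (h₁ : (G.map (evalC E w)).IsHermitian) (h₂ : (G'.map (evalC E w)).IsHermitian),
      (Finset.univ.filter fun i => 0 < h₁.eigenvalues i).card = (Finset.univ.filter fun i => 0 < h₂.eigenvalues i).card) :
    ∃ t : GL n (mixedSpace E), twistGram (conjMixed F E c) G t.val = G' := by
  have h₁ := isHermitian_map_evalC_of_transpose_map_conjMixed F E c hc hfix hG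
  have h₂ := isHermitian_map_evalC_of_transpose_map_conjMixed F E c hc hfix hG'
  have hd : ∀ {X : Matrix n n (mixedSpace E)}, IsUnit X.det → ∀ w : {w : InfinitePlace E // IsComplex w}, (X.map (evalC E w)).det ≠ 0 :=
    fun hX w => by
      rw [← RingHom.mapMatrix_apply, ← RingHom.map_det]
      exact (hX.map _).ne_zero
  choose g hg using fun w => exists_conjTranspose_mul_mul_eq_of_card_pos_eigenvalues_eq (h₁ w) (h₂ w) (hd hGd w) (hd hG'd w) (hsig w (h₁ w) (h₂ w))
  obtain ⟨T, hT⟩ := exists_matrix_forall_map_evalC_eq E (m := n) fun w => ((g w : GL n ℂ) : Matrix n n ℂ)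
  obtain ⟨T', hT'⟩ := exists_matrix_forall_map_evalC_eq E (m := n) fun w => (((g w)⁻¹ : GL n ℂ) : Matrix n n ℂ)
  have hTT' : T * T' = 1 := matrix_eq_of_forall_map_evalC_eq F E c hc hfix fun w => by
    rw [Matrix.map_mul, hT, hT', Matrix.map_one _ (map_zero _) (map_one _), ← Matrix.GeneralLinearGroup.coe_mul, mul_inv_cancel,
      Matrix.GeneralLinearGroup.coe_one]
  have hT'T : T' * T = 1 := matrix_eq_of_forall_map_evalC_eq F E c hc hfix fun w => by
    rw [Matrix.map_mul, hT, hT', Matrix.map_one _ (map_zero _) (map_one _), ← Matrix.GeneralLinearGroup.coe_mul, inv_mul_cancel,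
      Matrix.GeneralLinearGroup.coe_one]
  refine ⟨⟨T, T', hTT', hT'T⟩, matrix_eq_of_forall_map_evalC_eq F E c hc hfix fun w => ?_⟩
  change (twistGram (conjMixed F E c) G T).map (evalC E w) = _
  rw [twistGram_conjMixed_map_evalC F E c hc hfix, hT, hg]

end AnyIndex

/-! ## §3 The archimedean clause of local conjugacy at a singular class: equal BLOCK signatures ⇒ a `γ`-centralising congruence -/

section Frame

variable {N₁ N₂ : ℕ}

/-- `⊕ᶠ` is injective in the pair of blocks. [folklore] -/
private theorem finSum_injective_pair {S : Type*} [CommRing S] {A C : Matrix (Fin N₁) (Fin N₁) S} {B D : Matrix (Fin N₂) (Fin N₂) S}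
    (h : finSum N₁ N₂ A B = finSum N₁ N₂ C D) : A = C ∧ B = D := by
  have h' := (Matrix.reindex finSumFinEquiv finSumFinEquiv).injective h
  rw [Matrix.fromBlocks_inj] at h'
  exact ⟨h'.1, h'.2.2.2⟩

/-- The blocks of a hermitian block-diagonal matrix are hermitian. [folklore] -/
private theorem blocks_hermitian_pair {S : Type*} [CommRing S] (σ : S →+* S) {G₁ : Matrix (Fin N₁) (Fin N₁) S} {G₂ : Matrix (Fin N₂) (Fin N₂) S}
    (h : ((finSum N₁ N₂ G₁ G₂).map σ)ᵀ = finSum N₁ N₂ G₁ G₂) : (G₁.map σ)ᵀ = G₁ ∧ (G₂.map σ)ᵀ = G₂ := by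
  rw [transpose_finSum_map] at h
  exact finSum_injective_pair h

omit [NumberField E] in
include hc hfix in
/-- `c ⊗ 1` is an involution of `E ⊗ ℝ` when `c ≠ 1` fixes every infinite place (conjugation on each coordinate). [cite: BorelJacquet1979, §4.1] -/
theorem conjMixed_conjMixed_apply (x : mixedSpace E) : conjMixed F E c (conjMixed F E c x) = x :=
  mixedSpace_ext F E c hc hfix fun w => by
    have h1 := evalC_conjMixed F E c (hfix w.1) hc (conjMixed F E c x)
    have h2 := evalC_conjMixed F E c (hfix w.1) hc x
    simp only [evalC_apply] at h1 h2
    rw [h1, h2, starRingEnd_self_apply]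

omit [NumberField E] in
include hc hfix in
/-- **SAME BLOCK SIGNATURES AT EVERY COMPLEX PLACE ⇒ A `γ`-CENTRALISING CONGRUENCE OVER `E ⊗ ℝ`** — the archimedean clause of local conjugacy at
a SINGULAR semisimple class [Rogawski1990, Prop. 3.8.1 (d)], in the socket shape of ★ (h1) `exists_commute_twistGram_eq_of_det_blocks` (non-split
finite `v`) and ★ (h2) `exists_commute_twistGram_eq_of_split` (split finite `v`).  `γ` with an adapted frame `P` (`γ P = P (a·1 ⊕ᶠ b·1)`),
`G, G′` hermitian for `c ⊗ 1` with unit determinants and block diagonal in the frame (`ᵗ(σP) G P = G₁ ⊕ᶠ G₂`, `ᵗ(σP) G′ P = G′₁ ⊕ᶠ G′₂`); if at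
every complex place `w` the blocks `(G₁)_w, (G′₁)_w` have the same positive index and likewise `(G₂)_w, (G′₂)_w`, then some `t ∈ GL(E ⊗ ℝ)` commutes
with `γ` and has `ᵗ((c⊗1)t) · G · t = G′` (§2 blockwise, assembled by ★ `exists_commute_twistGram_eq_of_blocks`).  No definiteness is assumed:
at a real place of `F` where the form is indefinite this is the genuine archimedean condition. [cite: Rogawski1990, §3.8 Prop. 3.8.1 (d) p. 30; §3.3
Prop. 3.3.1 p. 22] [cite: HornJohnson2013, Thm. 4.5.8] -/
theorem exists_commute_twistGram_conjMixed_eq_of_block_signatures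
    {γ G G' : Matrix (Fin (N₁ + N₂)) (Fin (N₁ + N₂)) (mixedSpace E)} {P : GL (Fin (N₁ + N₂)) (mixedSpace E)} {a b : mixedSpace E}
    (hG : (G.map (conjMixed F E c))ᵀ = G) (hG' : (G'.map (conjMixed F E c))ᵀ = G') (hGd : IsUnit G.det) (hG'd : IsUnit G'.det)
    (hγP : γ * P.val = P.val *
      finSum N₁ N₂ (a • (1 : Matrix (Fin N₁) (Fin N₁) (mixedSpace E))) (b • (1 : Matrix (Fin N₂) (Fin N₂) (mixedSpace E))))
    {G₁ G'₁ : Matrix (Fin N₁) (Fin N₁) (mixedSpace E)} {G₂ G'₂ : Matrix (Fin N₂) (Fin N₂) (mixedSpace E)}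
    (hGP : twistGram (conjMixed F E c) G P.val = finSum N₁ N₂ G₁ G₂)
    (hG'P : twistGram (conjMixed F E c) G' P.val = finSum N₁ N₂ G'₁ G'₂)
    (hsig₁ : ∀ (w : {w : InfinitePlace E // IsComplex w}) (h₁ : (G₁.map (evalC E w)).IsHermitian) (h₂ : (G'₁.map (evalC E w)).IsHermitian),
      (Finset.univ.filter fun i => 0 < h₁.eigenvalues i).card = (Finset.univ.filter fun i => 0 < h₂.eigenvalues i).card)
    (hsig₂ : ∀ (w : {w : InfinitePlace E // IsComplex w}) (h₁ : (G₂.map (evalC E w)).IsHermitian) (h₂ : (G'₂.map (evalC E w)).IsHermitian),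
      (Finset.univ.filter fun i => 0 < h₁.eigenvalues i).card = (Finset.univ.filter fun i => 0 < h₂.eigenvalues i).card) :
    ∃ t : GL (Fin (N₁ + N₂)) (mixedSpace E),
      t.val * γ = γ * t.val ∧ twistGram (conjMixed F E c) G t.val = G' := by
  have hσ : ∀ x, conjMixed F E c (conjMixed F E c x) = x := conjMixed_conjMixed_apply F E c hc hfix
  -- the blocks are hermitian with unit determinants
  have hPG : ((twistGram (conjMixed F E c) G P.val).map (conjMixed F E c))ᵀ = twistGram (conjMixed F E c) G P.val :=
    conjTranspose_twistGram _ _ hσ hG _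
  have hPG' : ((twistGram (conjMixed F E c) G' P.val).map (conjMixed F E c))ᵀ = twistGram (conjMixed F E c) G' P.val :=
    conjTranspose_twistGram _ _ hσ hG' _
  rw [hGP] at hPG
  rw [hG'P] at hPG'
  obtain ⟨h₁, h₂⟩ := blocks_hermitian_pair (conjMixed F E c) hPG
  obtain ⟨h'₁, h'₂⟩ := blocks_hermitian_pair (conjMixed F E c) hPG'
  have hdG : G₁.det * G₂.det = conjMixed F E c P.val.det * G.det * P.val.det := by rw [← det_finSum, ← hGP, det_twistGram]
  have hdG' : G'₁.det * G'₂.det = conjMixed F E c P.val.det * G'.det * P.val.det := by rw [← det_finSum, ← hG'P, det_twistGram]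
  have hPd : IsUnit P.val.det := Matrix.isUnits_det_units P
  have hu : IsUnit (G₁.det * G₂.det) := hdG ▸ ((hPd.map (conjMixed F E c)).mul hGd).mul hPd
  have hu' : IsUnit (G'₁.det * G'₂.det) := hdG' ▸ ((hPd.map (conjMixed F E c)).mul hG'd).mul hPd
  obtain ⟨t₁, ht₁⟩ := exists_units_twistGram_conjMixed_eq_of_signatures F E c hc hfix h₁ h'₁ (isUnit_of_mul_isUnit_left hu)
    (isUnit_of_mul_isUnit_left hu') hsig₁
  obtain ⟨t₂, ht₂⟩ := exists_units_twistGram_conjMixed_eq_of_signatures F E c hc hfix h₂ h'₂ (isUnit_of_mul_isUnit_right hu)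
    (isUnit_of_mul_isUnit_right hu') hsig₂
  exact exists_commute_twistGram_eq_of_blocks (conjMixed F E c) hγP hGP hG'P t₁ ht₁ t₂ ht₂

/-- The top-left block of `A ⊕ᶠ B` (restriction along `Fin.castAdd`). [folklore] -/
private theorem finSum_submatrix_castAdd {S : Type*} [CommRing S] (A : Matrix (Fin N₁) (Fin N₁) S) (B : Matrix (Fin N₂) (Fin N₂) S) :
    (finSum N₁ N₂ A B).submatrix (Fin.castAdd N₂) (Fin.castAdd N₂) = A := by
  ext i j
  simp [finSum]

/-- The bottom-right block of `A ⊕ᶠ B` (restriction along `Fin.natAdd`). [folklore] -/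
private theorem finSum_submatrix_natAdd {S : Type*} [CommRing S] (A : Matrix (Fin N₁) (Fin N₁) S) (B : Matrix (Fin N₂) (Fin N₂) S) :
    (finSum N₁ N₂ A B).submatrix (Fin.natAdd N₁) (Fin.natAdd N₁) = B := by
  ext i j
  simp [finSum]

omit [NumberField E] in
include hc hfix in
/-- **Blocks of a positive definite form are positive definite**, read at a complex place `w`: if `G_w` is positive definite and
`ᵗ((c⊗1)P) · G · P = G₁ ⊕ᶠ G₂` with `P` invertible, then `(G₁)_w` and `(G₂)_w` are positive definite (congruence by the invertible `P_w`,
then restriction to the blocks). [cite: HornJohnson2013, §7.1, Obs. 7.1.2 (principal submatrices), Obs. 7.1.8 (*congruence by a matrix of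
full column rank)] -/
theorem posDef_blocks_map_evalC {G : Matrix (Fin (N₁ + N₂)) (Fin (N₁ + N₂)) (mixedSpace E)} (P : GL (Fin (N₁ + N₂)) (mixedSpace E))
    {G₁ : Matrix (Fin N₁) (Fin N₁) (mixedSpace E)} {G₂ : Matrix (Fin N₂) (Fin N₂) (mixedSpace E)}
    (hGP : twistGram (conjMixed F E c) G P.val = finSum N₁ N₂ G₁ G₂) (w : {w : InfinitePlace E // IsComplex w})
    (hw : (G.map (evalC E w)).PosDef) : (G₁.map (evalC E w)).PosDef ∧ (G₂.map (evalC E w)).PosDef := by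
  have hPd : IsUnit (P.val.map (evalC E w)).det := by
    rw [← RingHom.mapMatrix_apply, ← RingHom.map_det]
    exact (Matrix.isUnits_det_units P).map _
  have hPu : IsUnit (P.val.map (evalC E w)) := (Matrix.isUnit_iff_isUnit_det _).mpr hPd
  have hfin : (finSum N₁ N₂ (G₁.map (evalC E w)) (G₂.map (evalC E w))).PosDef := by
    rw [← finSum_map, ← hGP, twistGram_conjMixed_map_evalC F E c hc hfix]
    exact hw.conjTranspose_mul_mul_same (Matrix.mulVec_injective_of_isUnit hPu)
  constructor
  · have h := hfin.submatrix (Fin.castAdd_injective N₁ N₂)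
    rwa [finSum_submatrix_castAdd] at h
  · have h := hfin.submatrix (Fin.natAdd_injective N₂ N₁)
    rwa [finSum_submatrix_natAdd] at h

omit [NumberField E] in
include hc hfix in
/-- **BOTH FORMS POSITIVE DEFINITE AT EVERY COMPLEX PLACE ⇒ A `γ`-CENTRALISING CONGRUENCE OVER `E ⊗ ℝ`** — the archimedean clause (h3) in the
TOTALLY DEFINITE case: as `exists_commute_twistGram_conjMixed_eq_of_block_signatures`, with the block-signature hypotheses discharged from
`G_w ≫ 0`, `G′_w ≫ 0` (all blocks then have full positive index, `posDef_blocks_map_evalC` + `card_pos_eigenvalues_eq_card_of_posDef`).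
[cite: Rogawski1990, §3.8 Prop. 3.8.1 (d) p. 30; §3.3 Prop. 3.3.1 p. 22] [cite: HornJohnson2013, Thm. 4.5.8, §7.1 Obs. 7.1.8] -/
theorem exists_commute_twistGram_conjMixed_eq_of_posDef
    {γ G G' : Matrix (Fin (N₁ + N₂)) (Fin (N₁ + N₂)) (mixedSpace E)} {P : GL (Fin (N₁ + N₂)) (mixedSpace E)} {a b : mixedSpace E}
    (hG : (G.map (conjMixed F E c))ᵀ = G) (hG' : (G'.map (conjMixed F E c))ᵀ = G') (hGd : IsUnit G.det) (hG'd : IsUnit G'.det)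
    (hγP : γ * P.val = P.val *
      finSum N₁ N₂ (a • (1 : Matrix (Fin N₁) (Fin N₁) (mixedSpace E))) (b • (1 : Matrix (Fin N₂) (Fin N₂) (mixedSpace E))))
    {G₁ G'₁ : Matrix (Fin N₁) (Fin N₁) (mixedSpace E)} {G₂ G'₂ : Matrix (Fin N₂) (Fin N₂) (mixedSpace E)}
    (hGP : twistGram (conjMixed F E c) G P.val = finSum N₁ N₂ G₁ G₂)
    (hG'P : twistGram (conjMixed F E c) G' P.val = finSum N₁ N₂ G'₁ G'₂)
    (hpos : ∀ w : {w : InfinitePlace E // IsComplex w}, (G.map (evalC E w)).PosDef ∧ (G'.map (evalC E w)).PosDef) :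
    ∃ t : GL (Fin (N₁ + N₂)) (mixedSpace E),
      t.val * γ = γ * t.val ∧ twistGram (conjMixed F E c) G t.val = G' := by
  refine exists_commute_twistGram_conjMixed_eq_of_block_signatures F E c hc hfix hG hG' hGd hG'd hγP hGP hG'P (fun w h₁ h₂ => ?_)
    (fun w h₁ h₂ => ?_)
  · rw [card_pos_eigenvalues_eq_card_of_posDef (posDef_blocks_map_evalC F E c hc hfix P hGP w (hpos w).1).1 h₁,
      card_pos_eigenvalues_eq_card_of_posDef (posDef_blocks_map_evalC F E c hc hfix P hG'P w (hpos w).2).1 h₂]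
  · rw [card_pos_eigenvalues_eq_card_of_posDef (posDef_blocks_map_evalC F E c hc hfix P hGP w (hpos w).1).2 h₁,
      card_pos_eigenvalues_eq_card_of_posDef (posDef_blocks_map_evalC F E c hc hfix P hG'P w (hpos w).2).2 h₂]

end Frame

end Mixed

/-! ## §4 The CM editions: `F = L⁺`, `E = L`, `c` = complex conjugation (all side conditions discharged) -/

section CM

variable (L : Type) [Field L] [NumberField L] [IsCMField L] {N₁ N₂ : ℕ}

/-- **CM edition of `exists_units_twistGram_conjMixed_eq_of_signatures`**: over `L ⊗ ℝ` (`L` a CM field, involution `complexConj L ⊗ 1`),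
invertible hermitian matrices with the same positive index at every complex place are congruent. [cite: HornJohnson2013, Thm. 4.5.8]
[cite: Rogawski1990, §3.3 Prop. 3.3.1 p. 22] [cite: Landherr1936HermitianForms] -/
theorem exists_units_twistGram_arch_eq_of_signatures_cm {n : Type} [Fintype n] [DecidableEq n] {G G' : Matrix n n (mixedSpace L)}
    (hG : (G.map (conjMixed (↥(maximalRealSubfield L)) L (IsCMField.complexConj L)))ᵀ = G)
    (hG' : (G'.map (conjMixed (↥(maximalRealSubfield L)) L (IsCMField.complexConj L)))ᵀ = G') (hGd : IsUnit G.det) (hG'd : IsUnit G'.det)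
    (hsig : ∀ (w : {w : InfinitePlace L // IsComplex w}) (h₁ : (G.map (evalC L w)).IsHermitian) (h₂ : (G'.map (evalC L w)).IsHermitian),
      (Finset.univ.filter fun i => 0 < h₁.eigenvalues i).card = (Finset.univ.filter fun i => 0 < h₂.eigenvalues i).card) :
    ∃ t : GL n (mixedSpace L), twistGram (conjMixed (↥(maximalRealSubfield L)) L (IsCMField.complexConj L)) G t.val = G' :=
  exists_units_twistGram_conjMixed_eq_of_signatures _ L _ (IsCMField.complexConj_ne_one L) (complexConj_smul_infinitePlace L) hG hG' hGd hG'd hsig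

/-- **CM edition of the archimedean clause (h3′), signature form**: `exists_commute_twistGram_conjMixed_eq_of_block_signatures` over `L ⊗ ℝ` for a
CM field `L` — in the letters of the (h5) assembler (`σ_∞ := conjMixed L⁺ L (complexConj L)`; take `N₁ := 2`, `N₂ := 1` for `U(3)`).
[cite: Rogawski1990, §3.8 Prop. 3.8.1 (d) p. 30; §3.3 Prop. 3.3.1 p. 22] [cite: HornJohnson2013, Thm. 4.5.8] -/
theorem exists_commute_twistGram_arch_eq_of_block_signatures_cm
    {γ G G' : Matrix (Fin (N₁ + N₂)) (Fin (N₁ + N₂)) (mixedSpace L)} {P : GL (Fin (N₁ + N₂)) (mixedSpace L)} {a b : mixedSpace L}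
    (hG : (G.map (conjMixed (↥(maximalRealSubfield L)) L (IsCMField.complexConj L)))ᵀ = G)
    (hG' : (G'.map (conjMixed (↥(maximalRealSubfield L)) L (IsCMField.complexConj L)))ᵀ = G') (hGd : IsUnit G.det) (hG'd : IsUnit G'.det)
    (hγP : γ * P.val = P.val *
      finSum N₁ N₂ (a • (1 : Matrix (Fin N₁) (Fin N₁) (mixedSpace L))) (b • (1 : Matrix (Fin N₂) (Fin N₂) (mixedSpace L))))
    {G₁ G'₁ : Matrix (Fin N₁) (Fin N₁) (mixedSpace L)} {G₂ G'₂ : Matrix (Fin N₂) (Fin N₂) (mixedSpace L)}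
    (hGP : twistGram (conjMixed (↥(maximalRealSubfield L)) L (IsCMField.complexConj L)) G P.val = finSum N₁ N₂ G₁ G₂)
    (hG'P : twistGram (conjMixed (↥(maximalRealSubfield L)) L (IsCMField.complexConj L)) G' P.val = finSum N₁ N₂ G'₁ G'₂)
    (hsig₁ : ∀ (w : {w : InfinitePlace L // IsComplex w}) (h₁ : (G₁.map (evalC L w)).IsHermitian) (h₂ : (G'₁.map (evalC L w)).IsHermitian),
      (Finset.univ.filter fun i => 0 < h₁.eigenvalues i).card = (Finset.univ.filter fun i => 0 < h₂.eigenvalues i).card)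
    (hsig₂ : ∀ (w : {w : InfinitePlace L // IsComplex w}) (h₁ : (G₂.map (evalC L w)).IsHermitian) (h₂ : (G'₂.map (evalC L w)).IsHermitian),
      (Finset.univ.filter fun i => 0 < h₁.eigenvalues i).card = (Finset.univ.filter fun i => 0 < h₂.eigenvalues i).card) :
    ∃ t : GL (Fin (N₁ + N₂)) (mixedSpace L),
      t.val * γ = γ * t.val ∧ twistGram (conjMixed (↥(maximalRealSubfield L)) L (IsCMField.complexConj L)) G t.val = G' :=
  exists_commute_twistGram_conjMixed_eq_of_block_signatures _ L _ (IsCMField.complexConj_ne_one L) (complexConj_smul_infinitePlace L)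
    hG hG' hGd hG'd hγP hGP hG'P hsig₁ hsig₂

/-- **CM edition of the archimedean clause (h3), totally definite form**: `exists_commute_twistGram_conjMixed_eq_of_posDef` over `L ⊗ ℝ` for a CM
field `L`: `G_w ≫ 0` and `G′_w ≫ 0` at every complex place `w` ⇒ a `γ`-centralising `t ∈ GL(L ⊗ ℝ)` with `ᵗ(σ_∞ t) · G · t = G′`.
[cite: Rogawski1990, §3.8 Prop. 3.8.1 (d) p. 30; §3.3 Prop. 3.3.1 p. 22] [cite: HornJohnson2013, Thm. 4.5.8, §7.1 Obs. 7.1.8] -/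
theorem exists_commute_twistGram_arch_eq_of_posDef_cm
    {γ G G' : Matrix (Fin (N₁ + N₂)) (Fin (N₁ + N₂)) (mixedSpace L)} {P : GL (Fin (N₁ + N₂)) (mixedSpace L)} {a b : mixedSpace L}
    (hG : (G.map (conjMixed (↥(maximalRealSubfield L)) L (IsCMField.complexConj L)))ᵀ = G)
    (hG' : (G'.map (conjMixed (↥(maximalRealSubfield L)) L (IsCMField.complexConj L)))ᵀ = G') (hGd : IsUnit G.det) (hG'd : IsUnit G'.det)
    (hγP : γ * P.val = P.val *
      finSum N₁ N₂ (a • (1 : Matrix (Fin N₁) (Fin N₁) (mixedSpace L))) (b • (1 : Matrix (Fin N₂) (Fin N₂) (mixedSpace L))))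
    {G₁ G'₁ : Matrix (Fin N₁) (Fin N₁) (mixedSpace L)} {G₂ G'₂ : Matrix (Fin N₂) (Fin N₂) (mixedSpace L)}
    (hGP : twistGram (conjMixed (↥(maximalRealSubfield L)) L (IsCMField.complexConj L)) G P.val = finSum N₁ N₂ G₁ G₂)
    (hG'P : twistGram (conjMixed (↥(maximalRealSubfield L)) L (IsCMField.complexConj L)) G' P.val = finSum N₁ N₂ G'₁ G'₂)
    (hpos : ∀ w : {w : InfinitePlace L // IsComplex w}, (G.map (evalC L w)).PosDef ∧ (G'.map (evalC L w)).PosDef) :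
    ∃ t : GL (Fin (N₁ + N₂)) (mixedSpace L),
      t.val * γ = γ * t.val ∧ twistGram (conjMixed (↥(maximalRealSubfield L)) L (IsCMField.complexConj L)) G t.val = G' :=
  exists_commute_twistGram_conjMixed_eq_of_posDef _ L _ (IsCMField.complexConj_ne_one L) (complexConj_smul_infinitePlace L)
    hG hG' hGd hG'd hγP hGP hG'P hpos

end CM



end Literature.NumberTheory.Rogawski1990

end
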